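import Summits.QuantumFields.YangMills.Theorems.BalabanUVNodesN15TwoSpacingGluingCurvedKnitSmallFieldNodeObjects
import Summits.QuantumFields.YangMills.Theorems.BalabanUVNodesN15TwoSpacingGluingCurvedKnitCovariantLandauEtaDefect
import HarnessLib

/-!
# THE GLUING STEP AT TWO LATTICE SPACINGS — PROGRAMME (P-R), XIIa: THE NE2⁺ FAMILY OBJECTS WITH BAŁABAN's FULLY COVARIANT SUMMAND — entry 0 := the η-defect of the glued
# propagators of the cover whose summand is `P = N_L ⊗ 1 − N_V^Q − N_V^R = a·Q*(U)Q(U) − D_U(I−R(U))D*_U` and whose perturbation is `N_V^Q + N_V^R` (n15-c∕201, 206)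

Cell `pub-ymgap`, seat `pub-ymgap-dag-n15-c` (R134 (a); HUMAN RULING D-0062), generation 22.  `bears_on: R4∕N15 · K3⁸ SpineGivenEndpointR13SepCoPHV (stmt-QuantumFields-27366)`.
Filed `--supports stmt-QuantumFields-27366 --as helper` — COUNT-NEUTRAL.  PLUMBING definitions (3 `def`s + unfolding lemmas); 0 `sorry`.  n15-c∕189a (`…CovariantAveragingNodeObjects`)
VERBATIM with ONE change: entry 0 is n15-c∕206's operator pair (the Landau summand live as well).  The carriers, the class, the pairing and `sfInstance` are FILE 133's, unchanged.
Imports n15-c∕206 `…CovariantLandauEtaDefect` (`cvNVr'`; through it 201 `cvNVr`, 187a `cvNVq'`, 183 `cvNVq`) and FILE 133's objects.  Nothing in the tree is modified.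

* `sfqrEntry0` — entry 0: `idef P̂ P̂ (glued′(U′ = e^{η′A′}, P′ = N_L′⊗1 − N_V^Q′ − N_V^R′, N_V′ = N_V^Q′ + N_V^R′)) (glued(U = e^{ηĀ′}, P = N_L⊗1 − N_V^Q − N_V^R, N_V = N_V^Q + N_V^R))`.
* `sfqrOps` (entry 0 = `sfqrEntry0`, entries 1–3 the consumer's), `sfqrOps_zero`, `sfqrOps_of_ne_zero`; `sfqrFamily` (n15-b `opFamily`), `sfqrFamily_e`.

HONEST FRAMING ∕ LIMITS.  Typing only.  MODEL operator ∕ class ∕ pairing ∕ carriers; NE2⁺ NOT PRINTED; N15 of record untouched (DISCHARGED AS CONSUMED, p687738); counts UNMOVED (typed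
28∕28); one finite 𝕋⁴ at fixed ε per index — NOT infinite volume ∕ OS ∕ mass gap ∕ Clay.  Restate-immune (no Theses import).
-/

noncomputable section

open scoped BigOperators Matrix

namespace Summit.QuantumFields.YangMills.BalabanUVNodes.N15.Gluing

open Literature.MathematicalPhysics.QuantumFieldTheory.Balaban1983to89
open Literature.MathematicalPhysics.QuantumFieldTheory.Balaban1983to89.T4EtaRateDefect (idef)
open Literature.MathematicalPhysics.QuantumFieldTheory.Balaban1983to89.T4EtaRateCoeffDefect (pull)
open Literature.MathematicalPhysics.QuantumFieldTheory.Balaban1983to89.B11SectG (BlockNorm)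
open Summit.QuantumFields.YangMills.BalabanUVNodes.N15.BackgroundLayer (gavgM)
open Summit.QuantumFields.YangMills.BalabanUVNodes.N15.VectorPiece (bshiftEquiv kingPrV)
open Summit.QuantumFields.YangMills.BalabanUVNodes.N15.MatrixSpecies (liftMap liftBlk)
open Summit.QuantumFields.YangMills.BalabanUVNodes.N15.OperatorReadout (opGeo opFamily)

variable {d : ℕ}

section Family

open scoped Matrix.Norms.L2Operator

variable (d) {L : ℕ} [NeZero L] (mm ι : Type) [Fintype mm] [DecidableEq mm] [Fintype ι] [DecidableEq ι] (a : ℝ) (e : Matrix mm mm ℂ ≃L[ℝ] (ι → ℝ))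

/-- **ENTRY 0 OF THE (P-R) FAMILY**: the η-defect along King's bond pairing between the FINE glued operator (transporters `Ad_{e^{η′A′}}`, gauges `1`, Bałaban summand
`N_L′ ⊗ 1 − N_V^Q′ − N_V^R′` (covariant averaging AND covariant Landau term), perturbation `N_V^Q′ + N_V^R′`) and the COARSE one for the block mean `Ā′ = gavgM π̂ A′`
(`N_L ⊗ 1 − N_V^Q − N_V^R`, `N_V^Q + N_V^R`) — n15-c∕206's operator pair.
[cite: Balaban1985BackgroundPropagators, (3.26) p.395, (3.42) p.397 (first entry: shape), Thm 3.14 pp.426–427 (difference template)] -/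
def sfqrEntry0 (hL : Odd L ∧ 1 < L) (i : SfIdx d L) (A' : Fin (d + 1) → CvX' d L i.m i.kk i.r hL → Matrix mm mm ℂ) :
    (CvX d L i.m i.kk hL × ι → ℝ) →ₗ[ℝ] (CvX' d L i.m i.kk i.r hL × ι → ℝ) :=
  idef (pull (liftMap (kingPrV L i.kk i.r (cvM d L i.m i.kk hL)) ι)) (pull (liftMap (kingPrV L i.kk i.r (cvM d L i.m i.kk hL)) ι))
    (cvGlued' d L i.m i.kk i.r hL a ((((L ^ i.r * L ^ i.kk : ℕ) : ℝ))⁻¹) ι e (fun _ _ => (1 : Matrix mm mm ℂ)) (fun μ x' => NormedSpace.exp (((((L ^ i.r * L ^ i.kk : ℕ) : ℝ))⁻¹) • A' μ x')) (cvNL' d L i.m i.kk i.r hL a ι - (cvNVq' d L i.m i.kk i.r hL a ι e (fun μ x' => NormedSpace.exp (((((L ^ i.r * L ^ i.kk : ℕ) : ℝ))⁻¹) • A' μ x'))) - (cvNVr' d L i.m i.kk i.r hL a ι e (fun μ x' => NormedSpace.exp (((((L ^ i.r * L ^ i.kk : ℕ) : ℝ))⁻¹) • A' μ x')))) (fun _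 => (cvNVq' d L i.m i.kk i.r hL a ι e (fun μ x' => NormedSpace.exp (((((L ^ i.r * L ^ i.kk : ℕ) : ℝ))⁻¹) • A' μ x'))) + (cvNVr' d L i.m i.kk i.r hL a ι e (fun μ x' => NormedSpace.exp (((((L ^ i.r * L ^ i.kk : ℕ) : ℝ))⁻¹) • A' μ x')))))
    (cvGlued d L i.m i.kk hL a ((((L ^ i.kk : ℕ) : ℝ))⁻¹) ι e (fun _ _ => (1 : Matrix mm mm ℂ)) (fun μ x => NormedSpace.exp (((((L ^ i.kk : ℕ) : ℝ))⁻¹) • gavgM (Matrix mm mm ℂ) (Fin (d + 1)) (kingPrV L i.kk i.r (cvM d L i.m i.kk hL)) A' μ x)) (cvNL d L i.m i.kk hL a ι - (cvNVq d L i.m i.kk hL a ι e (fun μ x => NormedSpace.exp (((((L ^ i.kk : ℕ) : ℝ))⁻¹) • gavgM (Matrix mm mm ℂ) (Fin (d + 1)) (kingPrV L i.kk i.r (cvM d L i.m i.kk hL)) A' μ x))) - (cvNVr d L i.m i.kk hL a ι e (fun μ x => NormedSpace.exp (((((L ^ i.kk : ℕ) : ℝ))⁻¹) • gavgM (Matrix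 mm mm ℂ) (Fin (d + 1)) (kingPrV L i.kk i.r (cvM d L i.m i.kk hL)) A' μ x)))) (fun _ => (cvNVq d L i.m i.kk hL a ι e (fun μ x => NormedSpace.exp (((((L ^ i.kk : ℕ) : ℝ))⁻¹) • gavgM (Matrix mm mm ℂ) (Fin (d + 1)) (kingPrV L i.kk i.r (cvM d L i.m i.kk hL)) A' μ x))) + (cvNVr d L i.m i.kk hL a ι e (fun μ x => NormedSpace.exp (((((L ^ i.kk : ℕ) : ℝ))⁻¹) • gavgM (Matrix mm mm ℂ) (Fin (d + 1)) (kingPrV L i.kk i.r (cvM d L i.m i.kk hL)) A' μ x)))))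

/-- THE FOUR ENTRY OPERATORS: entry 0 = `sfqrEntry0`; entries 1–3 = the consumer's `E 1, E 2, E 3`. [cite: Balaban1985BackgroundPropagators, (3.42) p.397 (the four entries: shape)] -/
def sfqrOps (hL : Odd L ∧ 1 < L) (i : SfIdx d L) (E : Fin 4 → (Fin (d + 1) → CvX' d L i.m i.kk i.r hL → Matrix mm mm ℂ) → ((CvX d L i.m i.kk hL × ι → ℝ) →ₗ[ℝ] (CvX' d L i.m i.kk i.r hL × ι → ℝ))) :
    Fin 4 → (Fin (d + 1) → CvX' d L i.m i.kk i.r hL → Matrix mm mm ℂ) → ((CvX d L i.m i.kk hL × ι → ℝ) →ₗ[ℝ] (CvX' d L i.m i.kk i.r hL × ι → ℝ)) :=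
  fun n A' => ![sfqrEntry0 d mm ι a e hL i A', E 1 A', E 2 A', E 3 A'] n

/-- Unfolding: entry 0. [folklore] -/
@[simp] theorem sfqrOps_zero (hL : Odd L ∧ 1 < L) (i : SfIdx d L) (E : Fin 4 → (Fin (d + 1) → CvX' d L i.m i.kk i.r hL → Matrix mm mm ℂ) → ((CvX d L i.m i.kk hL × ι → ℝ) →ₗ[ℝ] (CvX' d L i.m i.kk i.r hL × ι → ℝ)))
    (A' : Fin (d + 1) → CvX' d L i.m i.kk i.r hL → Matrix mm mm ℂ) : sfqrOps d mm ι a e hL i E 0 A' = sfqrEntry0 d mm ι a e hL i A' := rfl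

/-- Unfolding: every entry other than entry 0 is the consumer's. [folklore] -/
theorem sfqrOps_of_ne_zero (hL : Odd L ∧ 1 < L) (i : SfIdx d L) (E : Fin 4 → (Fin (d + 1) → CvX' d L i.m i.kk i.r hL → Matrix mm mm ℂ) → ((CvX d L i.m i.kk hL × ι → ℝ) →ₗ[ℝ] (CvX' d L i.m i.kk i.r hL × ι → ℝ)))
    {n : Fin 4} (hn : n ≠ 0) (A' : Fin (d + 1) → CvX' d L i.m i.kk i.r hL → Matrix mm mm ℂ) : sfqrOps d mm ι a e hL i E n A' = E n A' := by
  fin_cases n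
  · exact absurd rfl hn
  all_goals rfl

/-- THE KERNEL FAMILY of the index for the (P-R) entries (n15-b `opFamily` on the product carriers: coarse blocks `liftBlk cvBlk ι`, fine blocks through King's pairing).
[cite: Balaban1985BackgroundPropagators, (3.42) p.397 (shape)] -/
def sfqrFamily (hL : Odd L ∧ 1 < L) (i : SfIdx d L) (E : Fin 4 → (Fin (d + 1) → CvX' d L i.m i.kk i.r hL → Matrix mm mm ℂ) → ((CvX d L i.m i.kk hL × ι → ℝ) →ₗ[ℝ] (CvX' d L i.m i.kk i.r hL × ι → ℝ))) :
    B9.KernelFamily (sfInstance d mm ι hL i).gc (sfInstance d mm ι hL i).Bf :=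
  show B9.KernelFamily (opGeo (sfGeo d hL i) (CvX d L i.m i.kk hL × ι) (liftBlk (cvBlk d L i.m i.kk hL) ι))
      (sfGaugeBg mm (Fin (d + 1)) (fun μ => bshiftEquiv (cvM d L i.m i.kk hL) (L ^ i.r * L ^ i.kk) μ) ((sfGeo d hL i).eta * ((sfGeo d hL i).L ^ i.r)⁻¹) (sfGeo d hL i).M) from
    opFamily (g := sfGeo d hL i) (liftBlk (cvBlk d L i.m i.kk hL) ι) (liftBlk (cvBlk d L i.m i.kk hL ∘ kingPrV L i.kk i.r (cvM d L i.m i.kk hL)) ι) (sfqrOps d mm ι a e hL i E)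

/-- Unfolding of the entries: the sharp fine-cube sup of the entry operator applied to the test function. [folklore] -/
theorem sfqrFamily_e (hL : Odd L ∧ 1 < L) (i : SfIdx d L) (E : Fin 4 → (Fin (d + 1) → CvX' d L i.m i.kk i.r hL → Matrix mm mm ℂ) → ((CvX d L i.m i.kk hL × ι → ℝ) →ₗ[ℝ] (CvX' d L i.m i.kk i.r hL × ι → ℝ)))
    (n : Fin 4) (A' : Fin (d + 1) → CvX' d L i.m i.kk i.r hL → Matrix mm mm ℂ) (lam : CvX d L i.m i.kk hL × ι → ℝ) (y : (sfGeo d hL i).Site) :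
    (sfqrFamily d mm ι a e hL i E).e n A' lam y =
      (BlockNorm.ofBlocks (sfGeo d hL i) (liftBlk (cvBlk d L i.m i.kk hL ∘ kingPrV L i.kk i.r (cvM d L i.m i.kk hL)) ι)).loc y (sfqrOps d mm ι a e hL i E n A' lam) := rfl

end Family

end Summit.QuantumFields.YangMills.BalabanUVNodes.N15.Gluing

end
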